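import Mathlib
import Summits.Ventures.PercRepro2.Defs
import Summits.Ventures.PercRepro2.Independence
import Summits.Ventures.PercRepro2.Harris
import Summits.Ventures.PercRepro2.CoinDefs
import Summits.Ventures.PercRepro2.CoinArcsOff
import Summits.Ventures.PercRepro2.CoinPendantDefs
import Summits.Ventures.PercRepro2.CoinPendant
import Summits.Ventures.PercRepro2.CoinInduced
import Summits.Ventures.PercRepro2.CoinVdBK
import Summits.Ventures.PercRepro2.CoinBHK
import Summits.Ventures.PercRepro2.CoinReverse
import Summits.Ventures.PercRepro2.CoinLemmaA
import Summits.Ventures.PercRepro2.CoinDarcMixed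
import Summits.Ventures.PercRepro2.CoinTwoPendantDefs
import Summits.Ventures.PercRepro2.CoinTwoPendantMass
import Summits.Ventures.PercRepro2.CoinTraceLevels
import Summits.Ventures.PercRepro2.CoinTraceTower
import Summits.Ventures.PercRepro2.CoinTraceReduce
import Summits.Ventures.PercRepro2.CoinTraceFn
import Summits.Ventures.PercRepro2.CoinTraceBlock
import Summits.Ventures.PercRepro2.CoinTraceShift
import Summits.Ventures.PercRepro2.CoinTwoStar
import Summits.Ventures.PercRepro2.CoinPivotalPair

/-!
# Row 2′DARC at the heads «the head forces all but one pendant vertex» (blind cell PercRepro2,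
night-2 g3; proofs/NIGHT2-DARC.md §17.7)

`P = insert v Z₁` with `w ∈ Z₁`, `v ∉ Z₁`, and `w ∈ K⁻` forcing every vertex of `Z₁` into `K⁻`
(every route from `w` to `t` passes through all of `Z₁`).  Then the only traces containing `w` are
`Z₁` and `P`, so `darc_of_pivotal_pair` applies: `darc_of_forcing_head`.  Instances: the
two-vertex head (`Z₁ = {w}`), the DIAMOND `w → v₁ → v₂ → t, w → v₂` (`Z₁ = {w, v₂}`, `v = v₁`),
the SIDE-BRANCH `w → v₁ → t, v₁ → v₂ → t` (`Z₁ = {w, v₁}`, `v = v₂`) — the three pendant heads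
of NIGHT2-DARC.md §15.8 whose pivotal family is a chain of length 2.
-/

namespace Summit.Ventures.PercRepro2.Coin

section Force

open Classical

variable {V : Type*} {E : Type*} [Fintype V] [DecidableEq V] [Fintype E] [DecidableEq E]
  {R : Type*} [Field R] [LinearOrder R] [IsStrictOrderedRing R]

omit [Fintype V] [Fintype E] [DecidableEq E] in
/-- When `w` forces `Z₁` into `K⁻`, every trace containing `w` other than `Z₁` and `insert v Z₁`
has an empty level. -/
lemma traceLevel_eq_empty_of_forces {arcs : E → Finset (V × V)} {t w v : V} {Z₁ : Finset V}
    (hwZ₁ : w ∈ Z₁) (hvZ₁ : v ∉ Z₁)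
    (hforce : ∀ ω : Config E, ω ∈ bwdEvent arcs w {t} → ∀ z ∈ Z₁, ω ∈ bwdEvent arcs z {t})
    {Z : Finset V} (hZ : Z ∈ (insert v Z₁).powerset) (hw : w ∈ Z) (h₁ : Z ≠ Z₁)
    (h₂ : Z ≠ insert v Z₁) : traceLevel arcs {t} (insert v Z₁) Z = ∅ := by
  ext ω
  simp only [Set.mem_empty_iff_false, iff_false]
  intro hω
  have hZP : Z ⊆ insert v Z₁ := Finset.mem_powerset.mp hZ
  have hwK : ω ∈ bwdEvent arcs w {t} := (hω w (Finset.mem_insert_of_mem hwZ₁)).mp hw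
  have hZ₁Z : Z₁ ⊆ Z := fun z hz =>
    (hω z (Finset.mem_insert_of_mem hz)).mpr (hforce ω hwK z hz)
  by_cases hv : v ∈ Z
  · apply h₂
    ext z
    constructor
    · exact fun h => hZP h
    · intro h
      rcases Finset.mem_insert.mp h with rfl | h
      · exact hv
      · exact hZ₁Z h
  · apply h₁
    ext z
    constructor
    · intro h
      rcases Finset.mem_insert.mp (hZP h) with rfl | h'
      · exact absurd h hv
      · exact h'
    · exact fun h => hZ₁Z h

/-- **THEOREM (row 2′DARC when the head forces all pendant vertices but one).** -/
theorem darc_of_forcing_head (p : E → R) (hp : IsProbVec p) {arcs : E → Finset (V × V)}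
    (hS : SameEnds arcs) {t w v : V} {Z₁ : Finset V} (hwZ₁ : w ∈ Z₁) (hvZ₁ : v ∉ Z₁)
    (hclosed : ClosedOut arcs (insert v Z₁) {t}) (hT : TailCoinsIn arcs (insert v Z₁) {t})
    (hforce : ∀ ω : Config E, ω ∈ bwdEvent arcs w {t} → ∀ z ∈ Z₁, ω ∈ bwdEvent arcs z {t})
    (s a b u : V) (ha : a ∉ insert v Z₁ ∪ {t}) (hb : b ∉ insert v Z₁ ∪ {t})
    (hu : u ∉ insert v Z₁ ∪ {t})
    (hP : ∀ Z ∈ (insert v Z₁).powerset,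
      0 < prob p (avoidEvent (arcsOff arcs (insert v Z₁ ∪ {t})) s (Z ∪ {t})))
    (hQ : ∀ Z ∈ (insert v Z₁).powerset,
      0 < prob p (avoidEvent (arcsOff arcs (insert v Z₁ ∪ {t})) s (gateTarget u w Z {t}))) :
    DARC p arcs s {t} a b u w :=
  darc_of_pivotal_pair p hp hS hclosed hT s a b u w (Finset.mem_insert_of_mem hwZ₁)
    (Finset.subset_insert v Z₁) hwZ₁
    (fun _ hZ hw h₁ h₂ => traceLevel_eq_empty_of_forces hwZ₁ hvZ₁ hforce hZ hw h₁ h₂)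
    ha hb hu hP hQ


/-- **THEOREM (row 2′DARC when the head forces the whole pendant set):** `w ∈ K⁻` forces every
vertex of `P` into `K⁻` (every route from `w` to `t` passes through all of `P` — pendant PATHS
of any length with arbitrary entries, for instance); then `P` is the only pivotal trace. -/
theorem darc_of_forcing_all (p : E → R) (hp : IsProbVec p) {arcs : E → Finset (V × V)}
    (hS : SameEnds arcs) {P : Finset V} {t w : V} (hwP : w ∈ P)
    (hclosed : ClosedOut arcs P {t}) (hT : TailCoinsIn arcs P {t})
    (hforce : ∀ ω : Config E, ω ∈ bwdEvent arcs w {t} → ∀ z ∈ P, ω ∈ bwdEvent arcs z {t})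
    (s a b u : V) (ha : a ∉ P ∪ {t}) (hb : b ∉ P ∪ {t}) (hu : u ∉ P ∪ {t})
    (hP : ∀ Z ∈ P.powerset, 0 < prob p (avoidEvent (arcsOff arcs (P ∪ {t})) s (Z ∪ {t})))
    (hQ : ∀ Z ∈ P.powerset,
      0 < prob p (avoidEvent (arcsOff arcs (P ∪ {t})) s (gateTarget u w Z {t}))) :
    DARC p arcs s {t} a b u w := by
  refine darc_of_pivotal_pair p hp hS hclosed hT s a b u w hwP (subset_refl P) hwP ?_ ha hb hu
    hP hQ
  intro Z hZ hw h₁ _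
  ext ω
  simp only [Set.mem_empty_iff_false, iff_false]
  intro hω
  apply h₁
  have hZP : Z ⊆ P := Finset.mem_powerset.mp hZ
  have hwK : ω ∈ bwdEvent arcs w {t} := (hω w hwP).mp hw
  exact Finset.Subset.antisymm hZP fun z hz => (hω z hz).mpr (hforce ω hwK z hz)

end Force

end Summit.Ventures.PercRepro2.Coin
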